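import Summits.RiemannHypothesis.RiemannHypothesis.Theses.JensenPolynomials
import Summits.RiemannHypothesis.RiemannHypothesis.Theorems.JensenPolynomialsFarSplitGlue
import Summits.RiemannHypothesis.RiemannHypothesis.Theorems.JensenPolynomialsFarGumbel
import Summits.RiemannHypothesis.RiemannHypothesis.Theorems.JensenPolynomialsXiCumulantSkew98Far
import Summits.RiemannHypothesis.RiemannHypothesis.Theorems.JensenPolynomialsXiCumulantMajorantCapFar

/-!
# Split closure of `XiGorttwCoeffSmallFar` (gate-written; R5, gate window 13, 2026-08-30)

Item stmt-RiemannHypothesis-19459 of route route-RiemannHypothesis-JensenPolynomials (`Summits.RiemannHypothesis.RiemannHypothesis.Theses.JensenPolynomials`) was split (gen 1) into 3 children + glue,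
and every child and the glue is closed·proved by an accepted theorem. This module states the derived theorem, so the parent's closer is a
real kernel-checked declaration (rulings 21-frontier F1/F2, 2026-08-30). Do not edit by hand: the gate regenerates it when the family changes.

children: XiWindowZeroFreeRelFar (stmt-RiemannHypothesis-19465, `Summit.RiemannHypothesis.RiemannHypothesis.Cruxes.XiWindowZeroFreeRelFar.FarGumbel.XiWindowZeroFreeRelFar_of`); XiCumulantSkew98Far (stmt-RiemannHypothesis-19466, `Summit.RiemannHypothesis.RiemannHypothesis.Theorems.JensenPolynomials.SkewFar.xiCumulantSkew98Far_item`); XiCumulantMajorantCapFar (stmt-RiemannHypothesis-19472, `Summit.RiemannHypothesis.RiemannHypothesis.Theorems.JensenPolynomials.CapCert.xiCumulantMajorantCapFar_item`)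
glue: XiGorttwCoeffSmallFarOfSplit (stmt-RiemannHypothesis-19473, `Summit.RiemannHypothesis.RiemannHypothesis.Theorems.JensenPolynomials.xiGorttwCoeffSmallFarOfSplit_item`)
-/

namespace Summit.RiemannHypothesis.RiemannHypothesis.Theorems.SplitClosure.JensenPolynomials

/-- `XiGorttwCoeffSmallFar` holds BY SPLIT (gen 1): the glue applied to the proved children. -/
theorem XiGorttwCoeffSmallFar_holds : _root_.Summit.RiemannHypothesis.RiemannHypothesis.Theses.JensenPolynomials.XiGorttwCoeffSmallFar :=
  (show _root_.Summit.RiemannHypothesis.RiemannHypothesis.Theses.JensenPolynomials.XiWindowZeroFreeRelFar → _root_.Summit.RiemannHypothesis.RiemannHypothesis.Theses.JensenPolynomials.XiCumulantSkew98Far → _root_.Summit.RiemannHypothesis.RiemannHypothesis.Theses.JensenPolynomials.XiCumulantMajorantCapFar → _root_.Summit.RiemannHypothesis.RiemannHypothesis.Theses.JensenPolynomials.XiGorttwCoeffSmallFar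
    from _root_.Summit.RiemannHypothesis.RiemannHypothesis.Theorems.JensenPolynomials.xiGorttwCoeffSmallFarOfSplit_item)
    (show _root_.Summit.RiemannHypothesis.RiemannHypothesis.Theses.JensenPolynomials.XiWindowZeroFreeRelFar from _root_.Summit.RiemannHypothesis.RiemannHypothesis.Cruxes.XiWindowZeroFreeRelFar.FarGumbel.XiWindowZeroFreeRelFar_of)
    (show _root_.Summit.RiemannHypothesis.RiemannHypothesis.Theses.JensenPolynomials.XiCumulantSkew98Far from _root_.Summit.RiemannHypothesis.RiemannHypothesis.Theorems.JensenPolynomials.SkewFar.xiCumulantSkew98Far_item)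
    (show _root_.Summit.RiemannHypothesis.RiemannHypothesis.Theses.JensenPolynomials.XiCumulantMajorantCapFar from _root_.Summit.RiemannHypothesis.RiemannHypothesis.Theorems.JensenPolynomials.CapCert.xiCumulantMajorantCapFar_item)

end Summit.RiemannHypothesis.RiemannHypothesis.Theorems.SplitClosure.JensenPolynomials
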